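import Literature.Probability.RandomPlanarGeometry.BrownianBridgeSplittingPlanar
import Literature.Probability.RandomPlanarGeometry.BrownianBridgeValueLaw
import HarnessLib

/-!
# The joint law of (piece before `u`, piece after `u`, value at `u`) of the planar unit bridge

Packaging of `BrownianBridgeSplittingPlanar` and `BrownianBridgeValueLaw` as ONE identity of
laws (the form consumed by path decompositions of the Brownian loop measure, Lawler,
*Conformally Invariant Processes in the Plane* (2005), §5.2, Chapman–Kolmogorov for
`μ(z, w; t)`): for the planar unit bridge `η` and `u ∈ [0, 1]`, the triple

  `(A, C, η_u)`,  `A_v = η_{uv} − v η_u`,  `C_v = η_{u+(1−u)v} − (1 − v) η_u`,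

has the PRODUCT law `Law(√u η) ⊗ Law(√(1−u) η) ⊗ Law(η_u)` on
`([0,1] → ℂ) × (([0,1] → ℂ) × ℂ)` (`map_split_triple`); and the bridge is recovered from the
triple (`unitBridge_fstTime_eq`, `unitBridge_sndTime_eq`).

## References

* G. F. Lawler, *Conformally Invariant Processes in the Plane*, AMS (2005), §5.2.
* O. Kallenberg, *Foundations of Modern Probability* (2nd ed., 2002), Ch. 13, Lemma 13.1.
-/

noncomputable section

open Set MeasureTheory ProbabilityTheory unitInterval
open scoped unitInterval NNReal ENNReal

namespace Literature.Probability.RandomPlanarGeometry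

open Literature.Probability.Process (WienerPair wienerPair)

namespace BrownianLoop

variable (u : I)

/-- Measurability of the first planar piece as a random element of `[0,1] → ℂ`. [folklore] -/
theorem measurable_splitFstC :
    Measurable fun (ω : WienerPair) (v : I) ↦ unitBridge ω (fstTime u v) - (v : ℝ) • unitBridge ω u :=
  measurable_pi_lambda _ fun v ↦ (measurable_unitBridge _).sub
    ((measurable_unitBridge u).const_smul (v : ℝ) :)

/-- Measurability of the second planar piece as a random element of `[0,1] → ℂ`. [folklore] -/
theorem measurable_splitSndC :
    Measurable fun (ω : WienerPair) (v : I) ↦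
      unitBridge ω (sndTime u v) - (1 - (v : ℝ)) • unitBridge ω u :=
  measurable_pi_lambda _ fun v ↦ (measurable_unitBridge _).sub
    ((measurable_unitBridge u).const_smul (1 - (v : ℝ)) :)

/-- **The joint law of `(A, C, η_u)` is the product `Law(√u η) ⊗ Law(√(1−u) η) ⊗ Law(η_u)`**:
the two re-bridged pieces of the planar unit bridge split at time `u` and the splitting value
are independent, with the laws of scaled unit bridges (`map_splitFstC`, `map_splitSndC`,
`indepFun_splitFstC`, `indepFun_splitSndC_unitBridge`). [cite: Lawler2005ConformallyInvariant, §5.2] -/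
theorem map_split_triple :
    wienerPair.map (fun ω ↦ ((fun v : I ↦ unitBridge ω (fstTime u v) - (v : ℝ) • unitBridge ω u),
        ((fun v : I ↦ unitBridge ω (sndTime u v) - (1 - (v : ℝ)) • unitBridge ω u),
          unitBridge ω u))) =
      (wienerPair.map (fun ω (v : I) ↦ (Real.sqrt u : ℂ) * unitBridge ω v)).prod
        ((wienerPair.map (fun ω (v : I) ↦ (Real.sqrt (1 - u) : ℂ) * unitBridge ω v)).prod
          (wienerPair.map (fun ω ↦ unitBridge ω u))) := by
  have hA := measurable_splitFstC u
  have hC := measurable_splitSndC u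
  have hM : Measurable fun ω : WienerPair ↦ unitBridge ω u := measurable_unitBridge u
  have h1 := (indepFun_iff_map_prod_eq_prod_map_map hA.aemeasurable
    (hC.prodMk hM).aemeasurable).1 (indepFun_splitFstC u)
  have h2 := (indepFun_iff_map_prod_eq_prod_map_map hC.aemeasurable hM.aemeasurable).1
    (indepFun_splitSndC_unitBridge u)
  rw [h1, h2, map_splitFstC, map_splitSndC]

/-- The bridge before time `u` from the triple: `η_{uv} = A_v + v η_u`. [folklore] -/
theorem unitBridge_fstTime_eq (ω : WienerPair) (v : I) :
    unitBridge ω (fstTime u v) =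
      (unitBridge ω (fstTime u v) - (v : ℝ) • unitBridge ω u) + (v : ℝ) • unitBridge ω u := by
  rw [sub_add_cancel]

/-- The bridge after time `u` from the triple: `η_{u+(1−u)v} = C_v + (1 − v) η_u`. [folklore] -/
theorem unitBridge_sndTime_eq (ω : WienerPair) (v : I) :
    unitBridge ω (sndTime u v) =
      (unitBridge ω (sndTime u v) - (1 - (v : ℝ)) • unitBridge ω u) +
        (1 - (v : ℝ)) • unitBridge ω u := by
  rw [sub_add_cancel]

end BrownianLoop

end Literature.Probability.RandomPlanarGeometry

end
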